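import Summits.RiemannHypothesis.RiemannHypothesis.Theorems.Splittings.JensenWindowDeGuaCount
import Summits.RiemannHypothesis.RiemannHypothesis.Theorems.TiltedLandingLaw421Seam01

/-! # LAW 421 kernel: COUPLES LOST IN A JENSEN WINDOW ⇒ an NL EVENT in the window's base (W-08 C4 «kernel desk», rh-idea-6 g27)

THIN ADAPTER from the tree's Jensen-window census (route LaguerreSpeiserSplit, `Theorems/Splittings/JensenWindowDeGuaCount.lean`,
`…JensenWindow.local_deGua_count` = Kim, PAMS 124 (1996) Thm 1 in window form: `2·[(non-real zeros of G in K°) − (non-real zeros of G′ in K°)]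
= KiKim.fourK (Re G|ℝ) α β`, and `Literature.Analysis.Complex.KiKim.fourK_nonneg_dvd_iff` = Ki–Kim 2000 (1.1)/(3.1): `fourK ≥ 0`, `4 ∣ fourK`,
`fourK = 0 ↔ no critical zero`) to the LAW's token `NLEventOf` (Seam01):

* `exists_nlEvent_of_fourK_ne_zero`: for real entire `G`, `fourK (Re G|ℝ) α β ≠ 0` on `[α, β]` with `G, G′ ≠ 0` at `α, β` ⇒ there is
  `c ∈ (α, β)` with `Re G′(c) = 0`, `Re G(c) ≠ 0`, `0 ≤ Re G(c)·Re G″(c)`;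
* ★ `exists_nlEventOf_of_window_loss`: `f` real entire of order `< 2` (`RealEntireLt2`), `K = [α,β] × [−h,h]` a Jensen WINDOW for `f^{(j)}`
  (`Window`: non-real boundary Jensen-clear, `f^{(j)}, f^{(j+1)} ≠ 0` at `α, β`), `f^{(j)}` with a zero; if the NON-REAL zero counts (with multiplicity,
  `zeroCountC`) of `f^{(j)}` and `f^{(j+1)}` in `K°` DIFFER, then `∃ c ∈ (α, β), NLEventOf f j c`. By `nonreal_zeros_deriv_le` they can differ only by
  `f^{(j+1)}` having FEWER («lost couples»), and the difference is `2·#(NL events in (α,β))` counted as in Ki–Kim (1.1).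

READING (C1/C3/C6): this is the WINDOWED, MULTIPLICITY-EXACT form of EXISTENCE («every couple of level `j` lost inside a Jensen window is paid by an NL
event of level `j` in the window's base»), complementing `RhW08.KiKim.nlEventOf_of_surplus` (`Theorems/TiltedLandingLaw421R3KiKim.lean` + bridge:
surplus of DISTINCT real zeros on `[a,b]`, no boundary clearance needed) and the ATTRIBUTION converse `RhW08.JensenShadow.jensenShadow_of_nlEventOf`
(C4 g27 087f1640: an NL event lies in the closed Jensen shadow of a non-real zero of `f^{(j)}`). Typed/proved ≠ the LAW; nothing here bears on the
truth of RH; RH is NOT proved; 24774 OPEN. -/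

noncomputable section

open Complex Set Metric
open Literature.Analysis.Complex
open Summit.RiemannHypothesis.RiemannHypothesis.Theorems.Splittings.JensenWindow
open RhIdea6.G17.W07C7

namespace RhW08.WindowLoss

/-- (K) a real value: `G x ≠ 0 ↔ Re G x ≠ 0` when `Im G x = 0`. -/
theorem re_ne_zero_of_ne_zero {w : ℂ} (him : w.im = 0) (hw : w ≠ 0) : w.re ≠ 0 :=
  fun h => hw (Complex.ext (by simpa using h) (by simpa using him))

/-- ★ `fourK ≠ 0` ⇒ an NL event: for entire `G` real on `ℝ`, on `[α, β]` (`α < β`) with `G α, G β, G′ α, G′ β ≠ 0`, if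
`KiKim.fourK (Re G|ℝ) α β ≠ 0` then some `c ∈ (α, β)` has `Re G′(c) = 0`, `Re G(c) ≠ 0` and `0 ≤ Re G(c)·Re G″(c)`
(Ki–Kim 2000 (3.1): `fourK = 0 ↔` no critical zero). -/
theorem exists_nlEvent_of_fourK_ne_zero {G : ℂ → ℂ} (hG : Differentiable ℂ G) (hreal : ∀ x : ℝ, (G x).im = 0)
    {α β : ℝ} (hab : α < β) (hα : G α ≠ 0) (hβ : G β ≠ 0) (hdα : deriv G α ≠ 0) (hdβ : deriv G β ≠ 0)
    (hK : KiKim.fourK (fun t : ℝ => (G t).re) α β ≠ 0) :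
    ∃ c ∈ Ioo α β, (deriv G c).re = 0 ∧ (G c).re ≠ 0 ∧ 0 ≤ (G c).re * (deriv (deriv G) c).re := by
  set F : ℝ → ℝ := fun t => (G t).re with hFdef
  have hFan : ∀ x, AnalyticAt ℝ F x := KiKim.analyticAt_re_ofReal hG
  have h1d : Differentiable ℂ (deriv G) := differentiable_deriv hG
  have hdF : deriv F = fun t : ℝ => (deriv G t).re :=
    funext fun t => (KiKim.hasDerivAt_re_ofReal (hG.differentiableAt)).deriv
  have hd2F : deriv (deriv F) = fun t : ℝ => (deriv (deriv G) t).re := by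
    rw [hdF]
    exact funext fun t => (KiKim.hasDerivAt_re_ofReal (h1d.differentiableAt)).deriv
  have dreal : ∀ t : ℝ, (deriv G t).im = 0 := im_deriv_ofReal hG hreal
  have hFα : F α ≠ 0 := re_ne_zero_of_ne_zero (hreal α) hα
  have hFβ : F β ≠ 0 := re_ne_zero_of_ne_zero (hreal β) hβ
  have hdFα : deriv F α ≠ 0 := by rw [hdF]; exact re_ne_zero_of_ne_zero (dreal α) hdα
  have hdFβ : deriv F β ≠ 0 := by rw [hdF]; exact re_ne_zero_of_ne_zero (dreal β) hdβ
  have hF' : deriv F ≠ 0 := fun h => hdFα (by rw [h]; rfl)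
  obtain ⟨-, -, hiff⟩ := KiKim.fourK_nonneg_dvd_iff hFan hF' hab hFα hdFα hFβ hdFβ
  have hnot : ¬ ∀ c ∈ Ioo α β, deriv F c = 0 → F c ≠ 0 → F c * deriv (deriv F) c < 0 := fun h => hK (hiff.2 h)
  push Not at hnot
  obtain ⟨c, hc, h1, h0, hle⟩ := hnot
  refine ⟨c, hc, ?_, h0, ?_⟩
  · simpa [hdF] using h1
  · simpa [hd2F] using hle

/-- (K) `RealEntireLt2` passes to every derivative (growth: `Literature.Analysis.Complex.exists_growth_iteratedDeriv`; realness: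
`im_iteratedDeriv_ofReal`). -/
theorem realEntireLt2_iteratedDeriv {f : ℂ → ℂ} (hf : RealEntireLt2 f) (j : ℕ) : RealEntireLt2 (iteratedDeriv j f) where
  diff := differentiable_iteratedDeriv_of_entire hf.diff j
  growth := by
    obtain ⟨ρ, C, hρ0, hρ, hgr⟩ := hf.growth
    obtain ⟨ρ', C', h1, h2, h3⟩ := exists_growth_iteratedDeriv hf.diff hρ0 hρ hgr j
    exact ⟨ρ', C', h1, h2, h3⟩
  real := im_iteratedDeriv_ofReal hf.diff hf.real j

/-- ★★ COUPLES LOST IN A JENSEN WINDOW ⇒ NL EVENT. `f` real entire of order `< 2`; `[α,β] × [−h,h]` a Jensen window for `f^{(j)}`; `f^{(j)}` has a zero.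
If the non-real zero counts (with multiplicity) of `f^{(j)}` and of `f^{(j+1)}` in the open window differ, then `∃ c ∈ (α, β), NLEventOf f j c`. -/
theorem exists_nlEventOf_of_window_loss {f : ℂ → ℂ} (hf : RealEntireLt2 f) (j : ℕ) {α β h : ℝ}
    (hW : Window (iteratedDeriv j f) α β h) (hex : ∃ a, iteratedDeriv j f a = 0)
    (hloss : zeroCountC (iteratedDeriv j f) (Ioo α β ×ℂ Ioo (-h) h)
        - zeroCountC (iteratedDeriv j f) ((Ioo α β ×ℂ Ioo (-h) h) ∩ {ρ | ρ.im = 0}) ≠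
      zeroCountC (iteratedDeriv (j + 1) f) (Ioo α β ×ℂ Ioo (-h) h)
        - zeroCountC (iteratedDeriv (j + 1) f) ((Ioo α β ×ℂ Ioo (-h) h) ∩ {ρ | ρ.im = 0})) :
    ∃ c ∈ Ioo α β, NLEventOf f j c := by
  have hG : RealEntireLt2 (iteratedDeriv j f) := realEntireLt2_iteratedDeriv hf j
  have hcount := local_deGua_count hG hW hex
  have e1 : deriv (iteratedDeriv j f) = iteratedDeriv (j + 1) f := by rw [← iteratedDeriv_succ]
  have e2 : deriv (deriv (iteratedDeriv j f)) = iteratedDeriv (j + 2) f := by rw [e1, ← iteratedDeriv_succ]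
  have hK : KiKim.fourK (fun t : ℝ => (iteratedDeriv j f t).re) α β ≠ 0 := by
    intro h0
    rw [h0, e1] at hcount
    apply hloss
    have : (2 : ℂ) ≠ 0 := two_ne_zero
    have h' := hcount
    push_cast at h'
    linear_combination h' / 2
  obtain ⟨c, hc, h1, h0, hle⟩ := exists_nlEvent_of_fourK_ne_zero hG.diff hG.real hW.lt hW.fα hW.fβ hW.dα hW.dβ hK
  refine ⟨c, hc, ?_, h0, ?_⟩
  · rw [← e1]; exact h1
  · rw [← e2]; exact hle

end RhW08.WindowLoss
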